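import Summits.QuantumFields.BalabanUV.T4Continuum.Support.NE7EnergyGradRateWSU2Log
import Summits.QuantumFields.BalabanUV.T4Continuum.Support.NE7EnergyRateWSU2End
import HarnessLib

/-!
# NE7EnergyGradRateWSU2LogEnd — supplier stub (S-g′)∕(S-h) of the NE7 crux (ROAD-G108 §3–§4): T-E_w♯ + (Gᶜ_w) IN THE CURRENCY OF ROUTE 1's END, FROM THE LOG-TOLERANT (10)-TYPE LETTERS —
# gen 108's `NE7EnergyGradRateWSU2End.ne3EnergyGradRateWSup_SU2_smallData` VERBATIM with the flux-gradient hypotheses weakened by the factor `(1+k)` (conclusion unchanged)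

Cell `pub-balaban`, rung (B)+1 sub-cell t4, lineage `b2b-balaban-t4-ne7-p1`, generation 108 (CRUX PROVER NE7 #1 = OWNER of BINDER row NE7).  Memo `t4/b2b-balaban-t4-ne7-p1-g108/ROAD-G108.md` §4.
WHY.  The planned supplier (S-h) of the pointwise flux-gradient regularity of minimisers (a flat sup letter with divergence-form source ∘ Weitzenböck ∘ Bianchi ∘ the pointwise tension of
tangent-critical configurations) carries a Calderón–Zygmund∕junction logarithm: its output is `‖∇_U F‖ ≤ c(1+k)η³`, not `cη³`.  This file (over `NE7EnergyGradRateWSU2Log`) and the END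
re-issue `NE7Route1EndDockedSmallDataSU2Log` make the END accept exactly that shape; the proof is gen 108's (`b = ε∕4` over the small data via gen 105's (8)∀, `residualScale_mono_b`).
WHAT ([folklore]; 0 def, 0 sorry).  **`ne3EnergyGradRateWSup_SU2_smallData_log`**.
HONEST FRAMING (page 1): composition; the log-tolerant flux-gradient letters are HYPOTHESES (weaker than [Balaban1985Variational] Thm 1 (10) TYPE; asserted for no minimiser); nothing of
Bałaban's asserted as an axiom; NOT NE3∕NE7 as spine nodes; spine count = dagwriter∕referees' call; SU(2), `L = 2`, finite 4-torus, constants existential; NOT infinite volume, NOT mass gap,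
NOT BetaPertH, NOT Clay (continuum YM on T⁴ ⇐ BetaPertH ∧ nine spine estimates).
-/

set_option autoImplicit false

open scoped BigOperators Matrix Matrix.Norms.L2Operator
open NormedSpace Finset Set

namespace Summit.QuantumFields.BalabanUV.T4Continuum.NE7EnergyGradRateWSU2LogEnd

open Literature.MathematicalPhysics.QuantumFieldTheory.Balaban1983to89
open B7Prop1Explicit B7Prop2Explicit
open T4AveragingDeficitWall (IsUnitaryCfg IsSkewDir SmallField vary Ad covGrad flux)
open T4AveragingDeficitWallBoundary (IsPeriodicCfg periodBox)
open AveragingDeficitPeriodicCounting (IsPeriodicDir)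
open MinimalActionSandwich (IsMinimiser)
open MinimalActionRate (sfClass Regular)
open NE3EnergyShapes (IsUnitarySite IsPeriodicSite residualScale residualScale_nonneg)
open NE3EnergyWeightedShapes (energyNormW energyNormW_nonneg)
open NE7EnergyGradRateWSU2Log (ne3EnergyGradRateWSup_SU2_log)
open NE7EnergyRateWSU2End (residualScale_mono_b)
open NE7AllMinimisersSmallSU2 (all_minimisers_small_SU2)

noncomputable section

variable {n : Type} [Fintype n] [DecidableEq n]

/-- **T-E_w♯ + (Gᶜ_w) IN THE END's CURRENCY, MODULO THE LOG-TOLERANT (10)-TYPE LETTERS** (statement in the file header). [folklore] -/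
theorem ne3EnergyGradRateWSup_SU2_smallData_log [Nonempty n] (hn : Fintype.card n = 2) :
    ∃ ε₀ : ℝ, 0 < ε₀ ∧ ∀ ε : ℝ, 0 < ε → ε ≤ ε₀ → ∀ (N : ℕ) [NeZero N], 1 ≤ N → ∃ δV : ℝ, 0 < δV ∧
      ∀ g c : ℝ, 0 < g → 0 ≤ c → ∀ θ : ℝ, 0 < θ → θ ^ 18 = (((2 : ℕ) : ℝ))⁻¹ →
      ∃ C ΛG : ℝ, 0 ≤ C ∧ 0 ≤ ΛG ∧
        ∀ dom : Set (Site 4 → Fin 4 → (Matrix n n ℂ)ˣ),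
          dom ⊆ {V : Site 4 → Fin 4 → (Matrix n n ℂ)ˣ | IsUnitaryCfg V ∧ IsPeriodicCfg V (N : ℤ) ∧ SmallField V δV} →
          ∀ k : ℕ, 1 ≤ k → ∀ V ∈ dom, ∀ UA UB : Site 4 → Fin 4 → (Matrix n n ℂ)ˣ,
            IsMinimiser 4 (sfClass 4 2 N ε) 2 N k V UA → IsMinimiser 4 (sfClass 4 2 N ε) 2 N (k + 1) V UB → Regular 4 2 N ε g (k + 1) UB →
            (∀ (x : Site 4) (κ : Fin 4) (π : T4AveragingDeficitWall.Plane 4), ‖covGrad UA (flux UA) x κ π‖ ≤ c * (1 + (k : ℝ)) / (((2 : ℕ) : ℝ) ^ k) ^ 3) →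
            (∀ (x : Site 4) (κ : Fin 4) (π : T4AveragingDeficitWall.Plane 4), ‖covGrad UB (flux UB) x κ π‖ ≤ c * (1 + ((k + 1 : ℕ) : ℝ)) / (((2 : ℕ) : ℝ) ^ (k + 1)) ^ 3) →
            ∃ (u : Site 4 → (Matrix n n ℂ)ˣ) (Z : Site 4 → Fin 4 → Matrix n n ℂ),
              IsUnitarySite u ∧ IsPeriodicSite u ((N * 2 ^ k : ℕ) : ℤ) ∧
              IsSkewDir Z ∧ IsPeriodicDir Z ((N * 2 ^ k : ℕ) : ℤ) ∧
              gaugeAct u UA = vary (rescale 2 (bavg 2 UB)) Z 1 ∧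
              energyNormW 2 k (rescale 2 (bavg 2 UB)) Z (periodBox (N * 2 ^ k)) ≤ C * residualScale 4 2 N ε g k ∧
              (∀ (κ : Fin 4) (x : Site 4) (μ : Fin 4),
                ‖Ad (rescale 2 (bavg 2 UB) (x + e κ) μ) (Z (x + e μ) κ) - Z x κ‖ ≤ ΛG * θ ^ (38 * k)) := by
  obtain ⟨ε₁, hε₁, H1⟩ := ne3EnergyGradRateWSup_SU2_log (n := n) hn
  obtain ⟨ε₂, hε₂, H2⟩ := all_minimisers_small_SU2 (n := n) hn
  refine ⟨min ε₁ (min ε₂ (1 / 10 ^ 8)), lt_min hε₁ (lt_min hε₂ (by norm_num)), ?_⟩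
  intro ε hε hεle N _ hN
  have hεε₁ : ε ≤ ε₁ := hεle.trans (min_le_left _ _)
  have hεε₂ : ε ≤ ε₂ := hεle.trans ((min_le_right _ _).trans (min_le_left _ _))
  have hε8 : ε ≤ 1 / 10 ^ 8 := hεle.trans ((min_le_right _ _).trans (min_le_right _ _))
  obtain ⟨δV, hδV, Hsmall⟩ := H2 ε hε hεε₂ N hN
  refine ⟨δV, hδV, ?_⟩
  intro g c hg hc θ hθ hθ18
  -- the theorem at `b = ε/4`: the line `ε/4 + 10⁸(ε/4)² ≤ ε`
  have hb : (0 : ℝ) ≤ ε / 4 := by positivity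
  have hbq : ε / 4 + 10 ^ 8 * (ε / 4) ^ 2 ≤ ε := by nlinarith
  obtain ⟨C, s, hC, -, HC⟩ := H1 ε hε hεε₁ (ε / 4) g c hb hbq hg hc θ hθ hθ18
  obtain ⟨ΛG, hΛG, HN⟩ := HC N
  refine ⟨C, ΛG, hC, hΛG, fun dom hdom => ?_⟩
  intro k hk V hV UA UB hA hB hreg hgA hgB
  -- every minimiser of the `ε`-class is `SmallField ((ε/4)/M²)`: `U_B` is `Regular (ε/4) g`
  have hsmallB := Hsmall V (hdom hV) (k + 1) UB hB
  have hreg' : Regular 4 2 N (ε / 4) g (k + 1) UB := ⟨hreg.unitary, hreg.periodic, hsmallB, hreg.grad⟩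
  obtain ⟨u, Z, hu, huP, hZs, hZP, hgauge, hE, -, hG⟩ := HN dom k hk V hV UA UB hA hB hreg' hgA hgB
  refine ⟨u, Z, hu, huP, hZs, hZP, hgauge, hE.trans (mul_le_mul_of_nonneg_left ?_ hC), hG⟩
  exact residualScale_mono_b 4 2 N k hb (by linarith)

end

end Summit.QuantumFields.BalabanUV.T4Continuum.NE7EnergyGradRateWSU2LogEnd
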